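import Summits.CriticalPhenomena.PercolationContinuityZ3.Theorems.SahiMasterFamilyPrincipalCapStep
import Mathlib.Data.Nat.Choose.Sum

/-!
# `F(16)` is FALSE: the abstract relaxation `PhiNonneg` fails at order sixteen (symmetric slice)

Unit `prim-masterthm-p4` (gen 15; crux anchor stmt-CriticalPhenomena-4575, helper work; memo
`run/shared/lean/prim/prim-masterthm/prim-masterthm-p4/P4-GEN15-REPORT.md` §1).  Companion of `…PrincipalCapBeta`
(`phiSet`, the conjecture-valued `PhiNonneg n` = "`F(n)`": `Φ_n(β) ≥ 0` for every `β : Finset (Fin n) → [0,1]` with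
`β univ = 1` and `β S · β T ≤ β (S ∪ T)`; `F(n) ⇒` Sahi's `C_n` on the principal-cap stratum, `F(n)` kernel for `n ≤ 7`).

**THEOREM (this file).** `not_phiNonneg_sixteen : ¬ PhiNonneg 16`.  The witness is SYMMETRIC (`β S` depends only on
`|S|`) and parity-patterned: **`β S = q` for `|S|` odd `≤ 11`, `β S = q²` for `|S|` even in `[2,12]`, `β S = 1` for `|S| ≥ 13`
and `S = ∅`, with `q = 199/200`** (`β S = q^{x(|S|)}`, `x = symProfile`).  The profile is subadditive in the required sense
(`x(u) ≤ x(s) + x(t)` whenever `max(s,t) ≤ u ≤ min(s+t,16)`: two odd sets with an even union is the tight case `q·q = q²`),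
so `β` is a feasible point of `F(16)`; and `Φ_16(β) = −121866188198602100794883920745961271352721 / (4096·10^32) ≈ −2.98·10^5 < 0`
exactly (three independent exact implementations agree: exponential-formula recursion, cycle-type sum, block recursion;
memo §1).  Mechanism (memo §1): in the small-defect regime `d = 1 − β = εx`, `Φ_k = ε²·Q(x) + O(ε³)` with
`Q(x) = Σ_i Σ_{B⊔B'=[k]−i} w_B w_{B'} x_B x_{B'} − Σ_{B⊔B'=[k]} w_B w_{B'} x_B x_{B'}` (`w_B = (|B|−1)!`); an alternating size
profile makes complementary pairs (sizes of equal parity when `k` is even) heavier than near-complementary ones, and the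
harmonic weights let this win from `k = 16` on (numerically `F(k)` holds on the symmetric slice for `k ≤ 15`).

TOOL (every order): `phiSym_succ`, the BLOCK RECURSION for symmetric set functions,
`Φ_{k+1}(f∘card) = k!·f(k+1) − Σ_{m<k} (k!/(k−m)!)·f(m+1)·Φ_{k−m}(f∘card)`, from Lieb–Sahi's block expansion
[LiebSahi2021, Prop. 3.4] in the canonical signed model (`CycleForm.sahiE_eq_sum_blocks`, as in `…PrincipalCapStep`): the honest
sub-functional on the complement of a block `B` is `Φ_{k+1−|B|}` of the SAME profile (`Finset.card_map`), and the blocks through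
the last index are counted by `Finset.sum_powerset_apply_card`.

CONSEQUENCES / HONEST FRAMING.  (1) `PhiNonneg 16` is refuted, so the reduction `…PrincipalCapBeta.sahiE_ind_nonneg_of_phiNonneg`
is VACUOUS at order 16: the LP-certificate programme `F(6), F(7), F(8), …` cannot reach all orders.  (2) This is NOT a
counterexample to Sahi's `C_16` / the principal-cap statement PC-16: the symmetric witness violates the linear "one-missing-face"
inequalities `Σ_{i∈B} β_{B∖i} ≤ 1 + (|B|−1)·β_B` that every event family satisfies (memo §2), i.e. it lies in the abstract
relaxation `X_16` but outside the G-system cone; Sahi's `C_k`, Kahn's Conjecture 5 and the master theorem remain OPEN.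
Axioms standard. [this work]
-/

noncomputable section

open scoped Classical

namespace Summit.CriticalPhenomena.PercolationContinuityZ3.Theorems

namespace PhiSymmetric

open Finset Function
open Literature.Combinatorics.Sahi2008
open Literature.Combinatorics.Sahi2008.CycleForm
open PrincipalCapBeta (phiSet realF realW)

/-! ### Symmetric set functions and the block recursion -/

/-- **`Φ_n` on the symmetric slice**: `phiSym f n := Φ_n(S ↦ f |S|)` for a size profile `f : ℕ → ℝ`. [this work] -/
def phiSym (f : ℕ → ℝ) (n : ℕ) : ℝ := phiSet n (fun S : Finset (Fin n) => f S.card)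

/-- `phiSym` unfolds. [this work] -/
theorem phiSym_def (f : ℕ → ℝ) (n : ℕ) : phiSym f n = phiSet n (fun S : Finset (Fin n) => f S.card) := rfl

variable {k : ℕ}

/-- The complementary factor of a proper block `B` in the canonical signed model is minus the honest sub-functional on
`Bᶜ`, re-indexed by an embedding of `Fin (n+1)` ONTO the complement (so `n + 1 + |B| = k + 1`); a cardinality-recording
version of `PrincipalCapStep.coRest_realF_eq` ([LiebSahi2021, Prop. 3.4] in the canonical model). [this work] -/
theorem coRest_realF_eq_card (β : Finset (Fin (k + 1)) → ℝ) {B : Finset (Fin (k + 1))} (hBu : B ≠ univ) :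
    ∃ (n : ℕ) (e : Fin (n + 1) ↪ Fin (k + 1)), (∀ j, e j ∉ B) ∧ n + 1 + B.card = k + 1 ∧
      coRest (realW β) realF B = -phiSet (n + 1) (fun S => β (S.map e)) := by
  obtain ⟨y, hy⟩ : ∃ y, y ∉ B := not_forall.1 (mt eq_univ_iff_forall.2 hBu)
  have hN : 0 < Fintype.card {x // x ∉ B} := Fintype.card_pos_iff.2 ⟨⟨y, hy⟩⟩
  obtain ⟨n, hn⟩ : ∃ n, Fintype.card {x // x ∉ B} = n + 1 := ⟨Fintype.card {x // x ∉ B} - 1, by omega⟩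
  let e0 : Fin (n + 1) ≃ {x // x ∉ B} := ((Fintype.equivFin {x // x ∉ B}).trans (finCongr hn)).symm
  let e : Fin (n + 1) ↪ Fin (k + 1) := e0.toEmbedding.trans (Embedding.subtype _)
  have hcard : n + 1 + B.card = k + 1 := by
    have h1 : Fintype.card {x // x ∉ B} = Fintype.card (Fin (k + 1)) - Fintype.card {x // x ∈ B} :=
      Fintype.card_subtype_compl _
    rw [Fintype.card_fin, Fintype.card_coe, hn] at h1
    have h2 : B.card ≤ k + 1 := by
      have := card_le_univ B
      rwa [Fintype.card_fin] at this
    omega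
  refine ⟨n, e, fun j => (e0 j).2, hcard, ?_⟩
  rw [coRest_of_ne_univ _ _ hBu, ← cycleSum_comp_equiv (realW β) e0 (fun j : {x // x ∉ B} => realF (j : Fin (k + 1))),
    ← sahiE_eq_cycleSum (realW β) (Nat.succ_le_succ (Nat.zero_le n)), PrincipalCapBeta.sahiE_eq_phiSet]
  congr 2
  funext S
  have e1 : (∏ x ∈ S, realF ((e0 x : {x // x ∉ B}) : Fin (k + 1))) = ∏ x ∈ S.map e, realF x := by
    rw [prod_map]; rfl
  rw [e1, PrincipalCapBeta.ex_realW_prod]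

/-- `Φ` of a symmetric set function only depends on the order: re-indexing lemma. [this work] -/
theorem phiSet_card_congr (f : ℕ → ℝ) {m m' : ℕ} (h : m = m') :
    phiSet m (fun S : Finset (Fin m) => f S.card) = phiSet m' (fun S : Finset (Fin m') => f S.card) := by
  subst h; rfl

/-- Blocks through a fixed point `a` are `insert a` of the subsets avoiding it: a sum over the former of a function of the
cardinality is a sum over the powerset of `univ.erase a`. [folklore] -/
theorem sum_filter_mem_eq_sum_powerset_erase {ι : Type*} [Fintype ι] [DecidableEq ι] (a : ι) (G : ℕ → ℝ) :
    ∑ B ∈ univ.filter (fun B : Finset ι => a ∈ B), G B.card =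
      ∑ A ∈ (univ.erase a).powerset, G (A.card + 1) := by
  refine Finset.sum_bij' (fun B _ => B.erase a) (fun A _ => insert a A) ?_ ?_ ?_ ?_ ?_
  · intro B hB
    exact mem_powerset.2 (erase_subset_erase a (subset_univ B))
  · intro A hA
    exact mem_filter.2 ⟨mem_univ _, mem_insert_self a A⟩
  · intro B hB
    exact insert_erase (mem_filter.1 hB).2
  · intro A hA
    have haA : a ∉ A := fun h => (notMem_erase a univ) (mem_powerset.1 hA h)
    exact erase_insert haA
  · intro B hB
    have ha : a ∈ B := (mem_filter.1 hB).2
    rw [card_erase_of_mem ha, Nat.sub_add_cancel (card_pos.2 ⟨a, ha⟩)]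

/-- **THE BLOCK RECURSION ON THE SYMMETRIC SLICE (every order).**  For every size profile `f : ℕ → ℝ`,
`Φ_{k+1}(f∘card) = k!·f(k+1) − Σ_{m<k} (k!/(k−m)!)·f(m+1)·Φ_{k−m}(f∘card)`
(Lieb–Sahi's block expansion along the last index: a block `B ∋ last` of size `m+1 ≤ k` contributes `m!·f(m+1)` times minus
the honest sub-functional on its complement, which is `Φ_{k−m}` of the same profile; there are `C(k,m)` such blocks and
`C(k,m)·m! = k!/(k−m)!`). [this work] -/
theorem phiSym_succ (f : ℕ → ℝ) (k : ℕ) :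
    phiSym f (k + 1) = (k.factorial : ℝ) * f (k + 1) -
      ∑ m ∈ range k, ((k.factorial : ℝ) / ((k - m).factorial : ℝ)) * f (m + 1) * phiSym f (k - m) := by
  set β : Finset (Fin (k + 1)) → ℝ := fun S => f S.card with hβdef
  set μ := realW β with hμ
  have hk : 1 ≤ k + 1 := Nat.succ_le_succ (Nat.zero_le k)
  -- the comparison coefficients, as a function of the block size
  set cR : ℕ → ℝ := fun m => if m = k + 1 then 1 else -phiSym f (k + 1 - m) with hcR
  set G : ℕ → ℝ := fun m => ((m - 1).factorial : ℝ) * (f m * cR m) with hG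
  have step1 : phiSym f (k + 1) = ∑ B ∈ univ.filter (fun B : Finset (Fin (k + 1)) => Fin.last k ∈ B), G B.card := by
    rw [phiSym_def, PrincipalCapBeta.phiSet_eq_sahiE_real, sahiE_eq_sum_blocks μ hk realF (Fin.last k)]
    refine sum_congr rfl fun B hB => ?_
    have mF : ex μ (fun x => ∏ j ∈ B, realF j x) = f B.card := by
      have e1 : (fun x => ∏ j ∈ B, realF j x) = ∏ j ∈ B, (realF j : Finset (Fin (k + 1)) → ℝ) :=
        funext fun x => (Finset.prod_apply x B _).symm
      rw [e1, PrincipalCapBeta.ex_realW_prod]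
    have mC : coRest μ realF B = cR B.card := by
      by_cases hBu : B = univ
      · rw [hBu, coRest_univ, hcR]
        simp only [card_univ, Fintype.card_fin, if_true]
      · obtain ⟨n, e, -, hcard, hc⟩ := coRest_realF_eq_card β hBu
        have hne : B.card ≠ k + 1 := by
          intro h
          exact hBu (eq_univ_of_card B (by rw [h, Fintype.card_fin]))
        rw [hc, hcR]
        simp only [hne, if_false]
        have hfun : (fun S : Finset (Fin (n + 1)) => β (S.map e)) = fun S => f S.card := by
          funext S; rw [hβdef]; simp only [card_map]
        rw [hfun, phiSym_def, phiSet_card_congr f (show n + 1 = k + 1 - B.card by omega)]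
    rw [mF, mC, hG]
  have step2 : ∑ B ∈ univ.filter (fun B : Finset (Fin (k + 1)) => Fin.last k ∈ B), G B.card =
      ∑ m ∈ range (k + 1), (k.choose m : ℝ) * G (m + 1) := by
    rw [sum_filter_mem_eq_sum_powerset_erase (Fin.last k) G, Finset.sum_powerset_apply_card (fun m => G (m + 1))]
    have hs : (univ.erase (Fin.last k) : Finset (Fin (k + 1))).card = k := by
      rw [card_erase_of_mem (mem_univ _), card_univ, Fintype.card_fin, Nat.add_sub_cancel]
    rw [hs]
    refine sum_congr rfl fun m _ => ?_
    rw [nsmul_eq_mul]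
  rw [step1, step2, sum_range_succ, Nat.choose_self, Nat.cast_one, one_mul]
  have htop : G (k + 1) = (k.factorial : ℝ) * f (k + 1) := by
    rw [hG, hcR]; simp only [Nat.add_sub_cancel, if_true, mul_one]
  have hterm : ∀ m ∈ range k, (k.choose m : ℝ) * G (m + 1) =
      -(((k.factorial : ℝ) / ((k - m).factorial : ℝ)) * f (m + 1) * phiSym f (k - m)) := by
    intro m hm
    have hmk : m < k := mem_range.1 hm
    have hne : m + 1 ≠ k + 1 := by omega
    have hsub : k + 1 - (m + 1) = k - m := by omega
    have hchoose : (k.choose m : ℝ) * (m.factorial : ℝ) = (k.factorial : ℝ) / ((k - m).factorial : ℝ) := by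
      have h := Nat.choose_mul_factorial_mul_factorial hmk.le
      have hpos : ((k - m).factorial : ℝ) ≠ 0 := Nat.cast_ne_zero.2 (Nat.factorial_ne_zero _)
      rw [eq_div_iff hpos]
      exact_mod_cast h
    rw [hG, hcR]
    simp only [Nat.add_sub_cancel, hne, if_false, hsub]
    rw [← hchoose]
    ring
  rw [htop, sum_congr rfl hterm, sum_neg_distrib]
  ring

/-! ### The order-sixteen witness -/

/-- The PARITY exponent profile of the witness (by set size): `x(j) = 1` for odd `j ≤ 11`, `2` for even `2 ≤ j ≤ 12`, `0` for `j = 0` and `j ≥ 13`. [this work] -/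
def symProfile (j : ℕ) : ℕ :=
  if j = 0 ∨ 13 ≤ j then 0 else if j % 2 = 1 then 1 else 2

/-- The witness profile `f(j) = (199/200)^{x(j)}`. [this work] -/
def f16 (j : ℕ) : ℝ := (199 / 200 : ℝ) ^ symProfile j

/-- The profile is subadditive in the sense forced by unions of sets of a 16-set. [this work] -/
theorem symProfile_subadd : ∀ s t u : Fin 17, max (s : ℕ) t ≤ u → (u : ℕ) ≤ s + t →
    symProfile u ≤ symProfile s + symProfile t := by
  decide

/-- `0 ≤ f`. [this work] -/
theorem f16_nonneg (j : ℕ) : 0 ≤ f16 j := pow_nonneg (by norm_num) _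

/-- `f ≤ 1`. [this work] -/
theorem f16_le_one (j : ℕ) : f16 j ≤ 1 := pow_le_one₀ (by norm_num) (by norm_num)

/-- Top value `f(16) = 1`. [this work] -/
theorem f16_univ : f16 (univ : Finset (Fin 16)).card = 1 := by
  rw [card_univ, Fintype.card_fin]; norm_num [f16, symProfile]

/-- **Feasibility**: the symmetric set function `S ↦ f(|S|)` on `Fin 16` is supermultiplicative under all unions. [this work] -/
theorem f16_supermul (S T : Finset (Fin 16)) : f16 S.card * f16 T.card ≤ f16 (S ∪ T).card := by
  have h1 : S.card ≤ (S ∪ T).card := card_le_card subset_union_left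
  have h2 : T.card ≤ (S ∪ T).card := card_le_card subset_union_right
  have h3 : (S ∪ T).card ≤ S.card + T.card := card_union_le S T
  have h4 : (S ∪ T).card ≤ 16 := (card_le_univ _).trans (by rw [Fintype.card_fin])
  have key := symProfile_subadd ⟨S.card, by omega⟩ ⟨T.card, by omega⟩ ⟨(S ∪ T).card, by omega⟩
    (by simp only [max_le_iff]; exact ⟨h1, h2⟩) h3
  unfold f16
  rw [← pow_add]
  exact pow_le_pow_of_le_one (by norm_num) (by norm_num) key

/-- `Φ_{1}` of the witness profile (block recursion, exact). [this work] -/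
theorem phiSym_f16_one : phiSym f16 1 = (199 : ℝ) / 200 := by
  rw [show (1 : ℕ) = 0 + 1 from rfl, phiSym_succ]
  simp only [Finset.sum_range_zero]
  norm_num [f16, symProfile, Nat.factorial]

/-- `Φ_{2}` of the witness profile (block recursion, exact). [this work] -/
theorem phiSym_f16_two : phiSym f16 2 = (0 : ℝ) := by
  rw [show (2 : ℕ) = 1 + 1 from rfl, phiSym_succ]
  simp only [Finset.sum_range_succ, Finset.sum_range_zero]
  norm_num [f16, symProfile, Nat.factorial, phiSym_f16_one]

/-- `Φ_{3}` of the witness profile (block recursion, exact). [this work] -/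
theorem phiSym_f16_three : phiSym f16 3 = (79401 : ℝ) / 4000000 := by
  rw [show (3 : ℕ) = 2 + 1 from rfl, phiSym_succ]
  simp only [Finset.sum_range_succ, Finset.sum_range_zero]
  norm_num [f16, symProfile, Nat.factorial, phiSym_f16_one, phiSym_f16_two]

/-- `Φ_{4}` of the witness profile (block recursion, exact). [this work] -/
theorem phiSym_f16_four : phiSym f16 4 = (-15800799 : ℝ) / 800000000 := by
  rw [show (4 : ℕ) = 3 + 1 from rfl, phiSym_succ]
  simp only [Finset.sum_range_succ, Finset.sum_range_zero]
  norm_num [f16, symProfile, Nat.factorial, phiSym_f16_one, phiSym_f16_two, phiSym_f16_three]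

/-- `Φ_{5}` of the witness profile (block recursion, exact). [this work] -/
theorem phiSym_f16_five : phiSym f16 5 = (28679402997 : ℝ) / 160000000000 := by
  rw [show (5 : ℕ) = 4 + 1 from rfl, phiSym_succ]
  simp only [Finset.sum_range_succ, Finset.sum_range_zero]
  norm_num [f16, symProfile, Nat.factorial, phiSym_f16_one, phiSym_f16_two, phiSym_f16_three, phiSym_f16_four]

/-- `Φ_{6}` of the witness profile (block recursion, exact). [this work] -/
theorem phiSym_f16_six : phiSym f16 6 = (-1902400398801 : ℝ) / 4000000000000 := by
  rw [show (6 : ℕ) = 5 + 1 from rfl, phiSym_succ]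
  simp only [Finset.sum_range_succ, Finset.sum_range_zero]
  norm_num [f16, symProfile, Nat.factorial, phiSym_f16_one, phiSym_f16_two, phiSym_f16_three, phiSym_f16_four, phiSym_f16_five]

/-- `Φ_{7}` of the witness profile (block recursion, exact). [this work] -/
theorem phiSym_f16_seven : phiSym f16 7 = (3062950680278601 : ℝ) / 640000000000000 := by
  rw [show (7 : ℕ) = 6 + 1 from rfl, phiSym_succ]
  simp only [Finset.sum_range_succ, Finset.sum_range_zero]
  norm_num [f16, symProfile, Nat.factorial, phiSym_f16_one, phiSym_f16_two, phiSym_f16_three, phiSym_f16_four, phiSym_f16_five, phiSym_f16_six]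

/-- `Φ_{8}` of the witness profile (block recursion, exact). [this work] -/
theorem phiSym_f16_eight : phiSym f16 8 = (-13722331777418212767 : ℝ) / 640000000000000000 := by
  rw [show (8 : ℕ) = 7 + 1 from rfl, phiSym_succ]
  simp only [Finset.sum_range_succ, Finset.sum_range_zero]
  norm_num [f16, symProfile, Nat.factorial, phiSym_f16_one, phiSym_f16_two, phiSym_f16_three, phiSym_f16_four, phiSym_f16_five, phiSym_f16_six, phiSym_f16_seven]

/-- `Φ_{9}` of the witness profile (block recursion, exact). [this work] -/
theorem phiSym_f16_nine : phiSym f16 9 = (32183955247238040412593 : ℝ) / 128000000000000000000 := by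
  rw [show (9 : ℕ) = 8 + 1 from rfl, phiSym_succ]
  simp only [Finset.sum_range_succ, Finset.sum_range_zero]
  norm_num [f16, symProfile, Nat.factorial, phiSym_f16_one, phiSym_f16_two, phiSym_f16_three, phiSym_f16_four, phiSym_f16_five, phiSym_f16_six, phiSym_f16_seven, phiSym_f16_eight]

/-- `Φ_{10}` of the witness profile (block recursion, exact). [this work] -/
theorem phiSym_f16_ten : phiSym f16 10 = (-2564635004169185938562019 : ℝ) / 1600000000000000000000 := by
  rw [show (10 : ℕ) = 9 + 1 from rfl, phiSym_succ]
  simp only [Finset.sum_range_succ, Finset.sum_range_zero]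
  norm_num [f16, symProfile, Nat.factorial, phiSym_f16_one, phiSym_f16_two, phiSym_f16_three, phiSym_f16_four, phiSym_f16_five, phiSym_f16_six, phiSym_f16_seven, phiSym_f16_eight, phiSym_f16_nine]

/-- `Φ_{11}` of the witness profile (block recursion, exact). [this work] -/
theorem phiSym_f16_eleven : phiSym f16 11 = (55641434312936448564962657283 : ℝ) / 2560000000000000000000000 := by
  rw [show (11 : ℕ) = 10 + 1 from rfl, phiSym_succ]
  simp only [Finset.sum_range_succ, Finset.sum_range_zero]
  norm_num [f16, symProfile, Nat.factorial, phiSym_f16_one, phiSym_f16_two, phiSym_f16_three, phiSym_f16_four, phiSym_f16_five, phiSym_f16_six, phiSym_f16_seven, phiSym_f16_eight, phiSym_f16_nine, phiSym_f16_ten]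

/-- `Φ_{12}` of the witness profile (block recursion, exact). [this work] -/
theorem phiSym_f16_twelve : phiSym f16 12 = (-18482066364924110450949424066089 : ℝ) / 102400000000000000000000000 := by
  rw [show (12 : ℕ) = 11 + 1 from rfl, phiSym_succ]
  simp only [Finset.sum_range_succ, Finset.sum_range_zero]
  norm_num [f16, symProfile, Nat.factorial, phiSym_f16_one, phiSym_f16_two, phiSym_f16_three, phiSym_f16_four, phiSym_f16_five, phiSym_f16_six, phiSym_f16_seven, phiSym_f16_eight, phiSym_f16_nine, phiSym_f16_ten, phiSym_f16_eleven]

/-- `Φ_{13}` of the witness profile (block recursion, exact). [this work] -/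
theorem phiSym_f16_thirteen : phiSym f16 13 = (530983771122684782726244473107229559 : ℝ) / 102400000000000000000000000000 := by
  rw [show (13 : ℕ) = 12 + 1 from rfl, phiSym_succ]
  simp only [Finset.sum_range_succ, Finset.sum_range_zero]
  norm_num [f16, symProfile, Nat.factorial, phiSym_f16_one, phiSym_f16_two, phiSym_f16_three, phiSym_f16_four, phiSym_f16_five, phiSym_f16_six, phiSym_f16_seven, phiSym_f16_eight, phiSym_f16_nine, phiSym_f16_ten, phiSym_f16_eleven, phiSym_f16_twelve]

/-- `Φ_{14}` of the witness profile (block recursion, exact). [this work] -/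
theorem phiSym_f16_fourteen : phiSym f16 14 = (364341129822732816972306031045237443 : ℝ) / 2560000000000000000000000000000 := by
  rw [show (14 : ℕ) = 13 + 1 from rfl, phiSym_succ]
  simp only [Finset.sum_range_succ, Finset.sum_range_zero]
  norm_num [f16, symProfile, Nat.factorial, phiSym_f16_one, phiSym_f16_two, phiSym_f16_three, phiSym_f16_four, phiSym_f16_five, phiSym_f16_six, phiSym_f16_seven, phiSym_f16_eight, phiSym_f16_nine, phiSym_f16_ten, phiSym_f16_eleven, phiSym_f16_twelve, phiSym_f16_thirteen]

/-- `Φ_{15}` of the witness profile (block recursion, exact). [this work] -/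
theorem phiSym_f16_fifteen : phiSym f16 15 = (13255357215400433236025874852967801393659 : ℝ) / 2048000000000000000000000000000000 := by
  rw [show (15 : ℕ) = 14 + 1 from rfl, phiSym_succ]
  simp only [Finset.sum_range_succ, Finset.sum_range_zero]
  norm_num [f16, symProfile, Nat.factorial, phiSym_f16_one, phiSym_f16_two, phiSym_f16_three, phiSym_f16_four, phiSym_f16_five, phiSym_f16_six, phiSym_f16_seven, phiSym_f16_eight, phiSym_f16_nine, phiSym_f16_ten, phiSym_f16_eleven, phiSym_f16_twelve, phiSym_f16_thirteen, phiSym_f16_fourteen]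

/-- `Φ_{16}` of the witness profile (block recursion, exact). [this work] -/
theorem phiSym_f16_sixteen : phiSym f16 16 = (-121866188198602100794883920745961271352721 : ℝ) / 409600000000000000000000000000000000 := by
  rw [show (16 : ℕ) = 15 + 1 from rfl, phiSym_succ]
  simp only [Finset.sum_range_succ, Finset.sum_range_zero]
  norm_num [f16, symProfile, Nat.factorial, phiSym_f16_one, phiSym_f16_two, phiSym_f16_three, phiSym_f16_four, phiSym_f16_five, phiSym_f16_six, phiSym_f16_seven, phiSym_f16_eight, phiSym_f16_nine, phiSym_f16_ten, phiSym_f16_eleven, phiSym_f16_twelve, phiSym_f16_thirteen, phiSym_f16_fourteen, phiSym_f16_fifteen]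

/-- **THEOREM: `F(16)` IS FALSE.**  The abstract relaxation `PhiNonneg 16` ("`Φ_16(β) ≥ 0` for every `β : 2^[16] → [0,1]`
with top value `1` and `β_S β_T ≤ β_{S∪T}`") fails at the symmetric parity point `β_S = (199/200)^{x(|S|)}` (`q` on odd sizes
`≤ 11`, `q²` on even sizes `≤ 12`, `1` from size `13` on): `Φ_16(β) = −121866188198602100794883920745961271352721/(4096·10^32) < 0`.  NOT a counterexample to Sahi's `C_16` (the witness is not the
conditional-moment function of any event family: it violates `Σ_{i∈B} β_{B∖i} ≤ 1 + (|B|−1)β_B`); Sahi's `C_k`, Kahn's Conjecture 5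
and the master theorem remain OPEN. [this work] -/
theorem not_phiNonneg_sixteen : ¬ PrincipalCapBeta.PhiNonneg 16 := by
  intro h
  have hβ := h (fun S : Finset (Fin 16) => f16 S.card) (fun B => f16_nonneg _) (fun B => f16_le_one _) f16_univ
    f16_supermul
  have hfold : phiSet 16 (fun S : Finset (Fin 16) => f16 S.card) = phiSym f16 16 := rfl
  rw [hfold, phiSym_f16_sixteen] at hβ
  norm_num at hβ

/-- The witness in words: a `[0,1]`-valued, normalised, supermultiplicative set function on `2^[16]` with negative `Φ_16`. [this work] -/
theorem exists_supermul_phiSet_neg : ∃ β : Finset (Fin 16) → ℝ, (∀ B, 0 ≤ β B) ∧ (∀ B, β B ≤ 1) ∧ β univ = 1 ∧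
    (∀ S T, β S * β T ≤ β (S ∪ T)) ∧ phiSet 16 β < 0 := by
  refine ⟨fun S => f16 S.card, fun B => f16_nonneg _, fun B => f16_le_one _, f16_univ, f16_supermul, ?_⟩
  have hfold : phiSet 16 (fun S : Finset (Fin 16) => f16 S.card) = phiSym f16 16 := rfl
  rw [hfold, phiSym_f16_sixteen]
  norm_num

end PhiSymmetric

end Summit.CriticalPhenomena.PercolationContinuityZ3.Theorems
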